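import Mathlib
import Summits.RiemannHypothesis.RiemannHypothesis.Theses.DensityLadder
import Summits.RiemannHypothesis.RiemannHypothesis.Theorems.DensityLadderSeparatedTowerExponent
import Summits.RiemannHypothesis.RiemannHypothesis.Theorems.DensityLadderSeparatedTowerMeanValue
import HarnessLib

/-!
# `DensityLadder.SeparatedTowerDensityLine` (item stmt-RiemannHypothesis-24918, crux K1 of LINE L57
# «sieve sight above the density line», rh-idea-10 g1) — CLOSER

The registered skeleton `Birth.lean`: K1 = S2 ∘ S1, with
S1 = `DensityLadderSeparatedTowerMeanValue.separatedTower_meanValueCount` (separated mean-value count on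
every line `σ₀ ∈ (1/2, β)`) and S2 = `DensityLadderSeparatedTowerExponent.separatedTower_exponentExtraction`
(exponent extraction).  The composition below is `SeparatedTowerDensityLine_of` of the skeleton, with the
route decl as its literal type.
Cell rh-split, seat rh-split-prover-l57 g0.  (p)/(b⁺) FRONTIER «DENSITY-LINE CAP», DH-capped; RH-free,
ζ-free; 0 toward RH; nothing here bears on the truth of RH.
-/

set_option linter.dupNamespace false  -- the mandated namespace repeats `RiemannHypothesis`

namespace Summit.RiemannHypothesis.RiemannHypothesis.Theorems.DensityLadderSeparatedTowerDensityLine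

open Summit.RiemannHypothesis.RiemannHypothesis.Theorems.DensityLadderSeparatedTowerExponent
open Summit.RiemannHypothesis.RiemannHypothesis.Theorems.DensityLadderSeparatedTowerMeanValue

/-- **K1 `SeparatedTowerDensityLine` holds** (stmt-RiemannHypothesis-24918): a `g`-separated tower of
off-line zeros of bounded multiplicity, consistent (via the smoothed explicit formula with an
integer-supported, log-bounded prime side) with a tame on-line family, has counting exponent
`e ≤ 2(1 − β)`.  Proof: S2 applied to S1. [folklore] -/
theorem separatedTowerDensityLine :
    Summit.RiemannHypothesis.RiemannHypothesis.Theses.DensityLadder.SeparatedTowerDensityLine := by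
  intro ι m ρ w β e g hβ hβ1 hg hC hT hTower
  exact separatedTower_exponentExtraction ι ρ β e hβ hβ1 hTower.2.1
    (separatedTower_meanValueCount ι m ρ w β g hβ hβ1 hg hC hT ⟨hTower.1, hTower.2.1, hTower.2.2.1⟩)
    hTower.2.2.2

end Summit.RiemannHypothesis.RiemannHypothesis.Theorems.DensityLadderSeparatedTowerDensityLine
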